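import Summits.ResolutionOfSingularities.ResolutionOfSingularities.Theorems.EquisingularLiftEquisingularLiftNatNoseTowerBDoublePrimeOfFact
import Summits.ResolutionOfSingularities.ResolutionOfSingularities.Theorems.EquisingularLiftEquisingularLiftNatDefNoseTowerBDoublePrimeResolutionOfHsub
import Summits.ResolutionOfSingularities.ResolutionOfSingularities.Theorems.EquisingularLiftEquisingularLiftNatTowerRoundFourDefs
import HarnessLib

/-!
# [OURS · L1 W4.5(b) · EL♮(3)] RUNG DEF-NOSE-TOWER-B″ AT `n = 3` — the T23-A″ target `stub_elnat_defNoseTowerBDoublePrimeResolutionThree`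
# (= TARGET-DEFNOSETOWERBPRIME-THREE 5759659e70196094 with `ReachNoseTowerBPrime ↦ ReachNoseTowerBDoublePrime`; to be DERIVED by the THIRTIETH registration,
# desk R20 (i)) CLOSED over the fact (T-k) `EmbeddedCurveLiftFact` (its first binder)

res-L1-w45b-stub-4 g11 (T23-A / A′ / A″ engine owner). OURS; pure composition; NOT a statement of any manuscript ([Hironaka2017] is a candidate under
adjudication, nothing of it is asserted); AI-written, weaker than expert review. No `sorry`; standard axioms; DEF-FREE.
`--supports stmt-ResolutionOfSingularities-20148 --as helper` (the text owner folds it by name at the swap, as p613422 / p605774).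
Proof = instance `stub_elnat_defNoseTowerBDoublePrimeResolution_of_hsubBDoublePrime` (…NatDefNoseTowerBDoublePrimeResolutionOfHsub) ∘ engine
`hsub_reachNoseTowerBDoublePrime_of_fact` (…NatNoseTowerBDoublePrimeOfFact), exactly as the B′ rung p613422.
-/

set_option linter.dupNamespace false -- mandated namespace `Summit.<Summit>.<Problem>` of this single-conjunct summit
set_option linter.overlappingInstances false -- signatures carry `[IsDomain O] [IsDiscreteValuationRing O]`

noncomputable section

open CategoryTheory CategoryTheory.Limits AlgebraicGeometry TopologicalSpace Topology IsLocalRing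
open Literature.AlgebraicGeometry.Resolution
open AlgebraicGeometry.Scheme.IdealSheafData
open Summit.ResolutionOfSingularities.ResolutionOfSingularities.Theses.EquisingularLift.Split
open Summit.ResolutionOfSingularities.ResolutionOfSingularities.Cruxes.EquisingularLift.StrataSplit

namespace Summit.ResolutionOfSingularities.ResolutionOfSingularities.Cruxes.EquisingularLiftNat.Sections

/-- **RUNG DEF-NOSE-TOWER-B″ at `n = 3`** — the T23-A″ nose rung target (TARGET 5759659e70196094 with `BPrime ↦ BDoublePrime`) over its first binder (T-k).
See the module docstring. [folklore; pure composition] [OURS · L1 W4.5b · T23-A″] -/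
theorem stub_elnat_defNoseTowerBDoublePrimeResolutionThree (p : ℕ) : EmbeddedCurveLiftFact → p.Prime → ∀ (k : Type) [Field k] [CharP k p] [IsAlgClosed k] (H : AlgebraicGeometry.Scheme.{0}) (ι : H ⟶ (Literature.AlgebraicGeometry.Motives.projectiveSpace 3 k).left), AlgebraicGeometry.IsClosedImmersion ι → AlgebraicGeometry.IsIntegral H → (∀ y : (Literature.AlgebraicGeometry.Motives.projectiveSpace 3 k).left, ∃ U : (Literature.AlgebraicGeometry.Motives.projectiveSpace 3 k).left.affineOpens, y ∈ (U : (Literature.AlgebraicGeometry.Motives.projectiveSpace 3 k).left.Opens) ∧ (ι.ker.ideal U).IsPrincipal) → (ReachNoseTowerBDoublePrime k 3 H ι) → ∃ (O : Type) (_ : CommRing O) (_ : IsDomain O) (_ : IsDiscreteValuationRing O) (_ : CharZero O) (π : O →+* k), Function.Surjective π ∧ (letI := MvPolynomial.gradedAlgebra (σ := Fin (3 + 1)) (R := O); letI := MvPolynomial.gradedAlgebra (σ := Fin (3 + 1)) (R := k); ∀ (φ : MvPolynomial.homogeneousSubmodule (Fin (3 + 1)) O →+*ᵍ MvPolynomial.homogeneousSubmodule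 (Fin (3 + 1)) k) (hφ' : HomogeneousIdeal.irrelevant (MvPolynomial.homogeneousSubmodule (Fin (3 + 1)) k) ≤ (HomogeneousIdeal.irrelevant (MvPolynomial.homogeneousSubmodule (Fin (3 + 1)) O)).map φ), (∀ s, φ s = MvPolynomial.map π s) → ∀ Y : Set (AlgebraicGeometry.Proj (MvPolynomial.homogeneousSubmodule (Fin (3 + 1)) O)), Y = Set.range (CategoryTheory.CategoryStruct.comp ι (AlgebraicGeometry.Proj.map φ hφ') : H ⟶ (AlgebraicGeometry.Proj (MvPolynomial.homogeneousSubmodule (Fin (3 + 1)) O))) → ∃ (P' : AlgebraicGeometry.Scheme.{0}) (σ : P' ⟶ (AlgebraicGeometry.Proj (MvPolynomial.homogeneousSubmodule (Fin (3 + 1)) O))) (S' : Set P'), (∀ Q : (∀ X' : AlgebraicGeometry.Scheme.{0}, (X' ⟶ (AlgebraicGeometry.Proj (MvPolynomial.homogeneousSubmodule (Fin (3 + 1)) O))) → Set X' → Prop), Q (AlgebraicGeometry.Proj (MvPolynomial.homogeneousSubmodule (Fin (3 + 1)) O)) (CategoryTheory.CategoryStruct.id _) Y → (∀ (X' X'' :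 AlgebraicGeometry.Scheme.{0}) (σ' : X' ⟶ (AlgebraicGeometry.Proj (MvPolynomial.homogeneousSubmodule (Fin (3 + 1)) O))) (Y' : Set X') (C : X'.IdealSheafData) (τ : X'' ⟶ X'), Q X' σ' Y' → Literature.AlgebraicGeometry.Resolution.IsBlowup τ C → Literature.AlgebraicGeometry.Resolution.Scheme.IsRegular C.subscheme → AlgebraicGeometry.Flat (CategoryTheory.CategoryStruct.comp C.subschemeι (CategoryTheory.CategoryStruct.comp σ' (CategoryTheory.CategoryStruct.comp (AlgebraicGeometry.Proj.toSpecZero (MvPolynomial.homogeneousSubmodule (Fin (3 + 1)) O)) (AlgebraicGeometry.Spec.map (CommRingCat.ofHom (algebraMap O (MvPolynomial.homogeneousSubmodule (Fin (3 + 1)) O 0))))))) → σ' '' (C.support : Set X') ⊆ {x | ¬ IsGenericPoint x Y} → (C.support : Set X') ∩ (CategoryTheory.CategoryStruct.comp σ' (CategoryTheory.CategoryStruct.comp (AlgebraicGeometry.Proj.toSpecZero (MvPolynomial.homogeneousSubmodule (Fin (3 + 1)) O)) (AlgebraicGeometry.Spec.map (CommRingCat.ofHom (algebraMap O (MvPolynomial.homogeneousSubmodule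 (Fin (3 + 1)) O 0)))))) ⁻¹' {IsLocalRing.closedPoint O} ⊆ Y' → Q X'' (CategoryTheory.CategoryStruct.comp τ σ') (closure (τ ⁻¹' (Y' \ (C.support : Set X'))))) → Q P' σ S') ∧ Literature.AlgebraicGeometry.Resolution.Scheme.IsRegular (AlgebraicGeometry.Scheme.IdealSheafData.vanishingIdeal (⟨closure S', isClosed_closure⟩ : TopologicalSpace.Closeds P')).subscheme) := by
  intro hF hp k _ _ _ H ι hι hH hloc hreach
  exact stub_elnat_defNoseTowerBDoublePrimeResolution_of_hsubBDoublePrime p hp k 3 H ι hι hH hloc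
    (fun O _ _ _ _ _ θ hθ P q Y Ch hChStep hChSplit hYsp hYirr hYcl hPint hPnoeth hPreg hqprop hqsm X' σ' S' hCh' hX'int hX'noeth hX'reg hX'dom F₁ hF₁ j t hsq T₁ hT₁cl hT₁irr hjT₁ Z hZ hZT₁ hT₁Z hZinf hZdim C hCsm hCreg hCfl hCj hCoff X₁ τ₁ hτ₁ hX₁int hX₁noeth hX₁reg hX₁dom F₂ hF₂ υ hυ j₂ t₂ hsq₂ hcomm hexc hirr₂ hCh₁ =>
      hsub_reachNoseTowerBDoublePrime_of_fact k O θ hθ P q Y Ch hChStep hChSplit hYsp hYirr hYcl hPint hPnoeth hPreg hqprop hqsm X' σ' S' hCh' hX'int hX'noeth hX'reg hX'dom F₁ hF₁ j t hsq T₁ hT₁cl hT₁irr hjT₁ Z hZ hZT₁ hT₁Z hZinf hZdim C hCsm hCreg hCfl hCj hCoff X₁ τ₁ hτ₁ hX₁int hX₁noeth hX₁reg hX₁dom F₂ hF₂ υ hυ j₂ t₂ hsq₂ hcomm hexc hirr₂ hCh₁ (hF k O θ hθ P q))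
    hreach

end Summit.ResolutionOfSingularities.ResolutionOfSingularities.Cruxes.EquisingularLiftNat.Sections

end
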